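import Literature.Geometry.Lorentzian.SpacetimeLocalConvergenceOfCharts
import Literature.Analysis.Calculus.SmoothArzelaAscoli
import HarnessLib

/-!
# Local Cheeger–Gromov compactness: uniformly tame pointed spacetimes subconverge on a chart

**Theorem (`Spacetime.exists_nearMinkowskiChart_subconvergesLocallyTo`).** Let `(𝓢ₙ, pₙ)` be
pointed spacetimes carrying smooth injective chart maps `Ψₙ : ↥O → 𝓢ₙ` on a common connected open
set `O ⊆ E4`, centred at `y₀` (`Ψₙ y₀ = pₙ`), pushing `∂₀` to the future at the centre, with
deviations `hₙ = Ψₙ^* gₙ − η` that are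

* uniformly `C⁰`-PINCHED: `‖hₙ(y)‖ ≤ θ < 1` on `O`, and
* bounded IN EVERY `Cᵏ` uniformly in `n`: `sup_{O} ‖Dᵐ hₙ‖ ≤ Λ_k` for `m ≤ k`, every `k`

(the per-point clause of the uniform-tameness hypotheses of the Final State Conjecture routes, at
all orders). Then there are a strictly increasing `φ` and a near-Minkowski field `G` on `O`
(`NearMinkowskiChart O`: smooth, symmetric, `‖G − η‖ ≤ θ`) such that

1. the deviations `h_{φ j}` converge to `G − η` in `Cᵏ` on every compact subset of `O`, for every
   `k` (`C^∞_loc` convergence of the metric components), and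
2. `(𝓢ₙ, pₙ) ⇀ ((O, G, ∂₀), y₀)` in the pointed `Cᵏ_loc` sense (`Spacetime.SubconvergesLocallyTo`)
   for EVERY `k`, the comparison maps being the charts `Ψ_{φ j}` themselves.

This is the local (one-chart) form of the Cheeger–Gromov compactness theorem (Petersen 2006, Ch. 10,
§3.2, Thm. 72 / Lemma 74 "convergence of the metric coefficients in the charts"; Anderson 2004,
§1) for Lorentzian metrics, where no distance function organises a covering: since the tree's
`SubconvergesLocallyTo` carries no covering clause, the chart domain with the limit components IS a
limit. It is the first PRODUCER of `SubconvergesLocallyTo` limits from tameness; the algebra of such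
limits (restriction, diagonal/translation, base-point adjustment, isometry invariance) is in the
`SpacetimeLocalConvergence*.lean` files. All-orders bounds are needed for a smooth (`Spacetime`)
limit: with `C^{k+1}` bounds only, the same proof gives a `Cᵏ` limit field (`ChartMetricCompactness.lean`)
which is not a `Spacetime`.

Proof. The components `Hₙ = metricInCoords (Ψₙ ∘ (chartAt E4 y₀).symm) − η` are smooth on `O` and
have the germs of the deviations (`BackgroundChartCalculus.lean`), hence the same bounds; the `C^∞`
Arzelà–Ascoli theorem (`SmoothArzelaAscoli.lean`) extracts `φ` and a smooth limit `H`; `G = H + η`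
is symmetric and pinched as a pointwise limit, and `SubconvergesLocallyTo.ofCharts`
(`SpacetimeLocalConvergenceOfCharts.lean`) turns the `Cᵏ` convergence of the components into the
subconvergence datum.

## References
* P. Petersen, *Riemannian Geometry*, 2nd ed., GTM 171, Springer 2006, Ch. 10, §3.2. [Petersen2006]
* M. T. Anderson, Cheeger–Gromov theory and applications to general relativity, 2004, §1. [Anderson2004]
-/

noncomputable section

open Set Metric Filter Topology Function TopologicalSpace
open scoped Manifold ContDiff Topology ENNReal

universe u

namespace Literature.Geometry.Lorentzian

open Literature.Analysis.Calculus

section SupNorm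

variable {F W : Type*} [NormedAddCommGroup F] [NormedSpace ℝ F] [NormedAddCommGroup W]
  [NormedSpace ℝ W]

/-- **`Cᵏ` sup-norm convergence from eventual uniform smallness of the derivatives** (the
conversion used by the `Cᵏ` compactness theorems): if for every `ε > 0` eventually
`‖Dⁱ Gₙ(x) − Dⁱ G(x)‖ < ε` for all `i ≤ k`, `x ∈ K`, and `Gₙ`, `G` are `Cᵏ` at the points of `K`,
then `supCkENorm K k (Gₙ − G) → 0`. [folklore] -/
theorem tendsto_supCkENorm_sub_of_eventually_lt {k : ℕ} {G : ℕ → F → W} {Glim : F → W} {K : Set F}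
    (hG : ∀ n, ∀ x ∈ K, ContDiffAt ℝ k (G n) x) (hGlim : ∀ x ∈ K, ContDiffAt ℝ k Glim x)
    (hev : ∀ ε > 0, ∀ᶠ n in atTop, ∀ i, i ≤ k → ∀ x ∈ K,
      ‖iteratedFDeriv ℝ i (G n) x - iteratedFDeriv ℝ i Glim x‖ < ε) :
    Tendsto (fun n ↦ supCkENorm K k (G n - Glim)) atTop (𝓝 0) := by
  rw [ENNReal.tendsto_nhds_zero]
  intro ε hε
  rcases eq_top_or_lt_top ε with rfl | hεtop
  · exact Eventually.of_forall fun _ ↦ le_top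
  have hεr : 0 < ε.toReal := ENNReal.toReal_pos hε.ne' hεtop.ne
  filter_upwards [hev ε.toReal hεr] with n hn
  rw [← ENNReal.ofReal_toReal hεtop.ne]
  refine supCkENorm_le_ofReal fun m hm x hx ↦ ?_
  rw [iteratedFDeriv_sub_apply ((hG n x hx).of_le (by exact_mod_cast hm))
    ((hGlim x hx).of_le (by exact_mod_cast hm))]
  exact (hn m hm x hx).le

/-- **Pointwise convergence of a derivative from `Cᵏ` sup-norm convergence** on a set containing
the point. [folklore] -/
theorem tendsto_iteratedFDeriv_of_tendsto_supCkENorm {k m : ℕ} (hm : m ≤ k) {G : ℕ → F → W}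
    {Glim : F → W} {K : Set F} {x : F} (hx : x ∈ K) (hG : ∀ n, ContDiffAt ℝ k (G n) x)
    (hGlim : ContDiffAt ℝ k Glim x)
    (h : Tendsto (fun n ↦ supCkENorm K k (G n - Glim)) atTop (𝓝 0)) :
    Tendsto (fun n ↦ iteratedFDeriv ℝ m (G n) x) atTop (𝓝 (iteratedFDeriv ℝ m Glim x)) := by
  rw [tendsto_iff_norm_sub_tendsto_zero]
  have hle : ∀ n, ‖iteratedFDeriv ℝ m (G n) x - iteratedFDeriv ℝ m Glim x‖ₑ ≤
      supCkENorm K k (G n - Glim) := fun n ↦ by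
    rw [← iteratedFDeriv_sub_apply ((hG n).of_le (by exact_mod_cast hm))
      (hGlim.of_le (by exact_mod_cast hm))]
    exact enorm_iteratedFDeriv_le_supCkENorm hm hx _
  have h0 : Tendsto (fun n ↦ ‖iteratedFDeriv ℝ m (G n) x - iteratedFDeriv ℝ m Glim x‖ₑ) atTop
      (𝓝 0) :=
    tendsto_of_tendsto_of_tendsto_of_le_of_le tendsto_const_nhds h (fun _ ↦ bot_le) hle
  have h1 : Tendsto (fun n ↦ (‖iteratedFDeriv ℝ m (G n) x - iteratedFDeriv ℝ m Glim x‖ₑ).toReal)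
      atTop (𝓝 (0 : ℝ≥0∞).toReal) :=
    (ENNReal.tendsto_toReal ENNReal.zero_ne_top).comp h0
  rw [ENNReal.toReal_zero] at h1
  refine h1.congr fun n ↦ ?_
  rw [← ofReal_norm, ENNReal.toReal_ofReal (norm_nonneg _)]

/-- Order-zero case: pointwise convergence of the maps themselves. [folklore] -/
theorem tendsto_apply_of_tendsto_supCkENorm {k : ℕ} {G : ℕ → F → W} {Glim : F → W} {K : Set F}
    {x : F} (hx : x ∈ K) (hG : ∀ n, ContDiffAt ℝ k (G n) x) (hGlim : ContDiffAt ℝ k Glim x)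
    (h : Tendsto (fun n ↦ supCkENorm K k (G n - Glim)) atTop (𝓝 0)) :
    Tendsto (fun n ↦ G n x) atTop (𝓝 (Glim x)) := by
  have h1 := tendsto_iteratedFDeriv_of_tendsto_supCkENorm (Nat.zero_le k) hx hG hGlim h
  have h2 : Tendsto (fun n ↦ (iteratedFDeriv ℝ 0 (G n) x) 0) atTop
      (𝓝 ((iteratedFDeriv ℝ 0 Glim x) 0)) :=
    ((ContinuousMultilinearMap.apply ℝ (fun _ : Fin 0 ↦ F) W 0).continuous.tendsto _).comp h1
  simpa only [iteratedFDeriv_zero_apply] using h2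

/-- **The `C^∞` Arzelà–Ascoli theorem in `supCkENorm` form, with pointwise convergence**: smooth
fields on an open set of a finite-dimensional space, bounded in every `Cⁱ` on compacts uniformly in
`n`, subconverge in every `Cᵏ` sup norm on compacts (and pointwise) to a smooth field.
[cite: Petersen2006, Ch. 10 §3.1] -/
theorem exists_strictMono_contDiffOn_infty_tendsto_supCkENorm_sub [FiniteDimensional ℝ F]
    [FiniteDimensional ℝ W] {O : Set F} (hO : IsOpen O) {H : ℕ → F → W}
    (hHs : ∀ n, ContDiffOn ℝ ∞ (H n) O)
    (hb : ∀ (i : ℕ), ∀ K ⊆ O, IsCompact K → ∃ Λ : ℝ, ∀ n, ∀ z ∈ K, ‖iteratedFDeriv ℝ i (H n) z‖ ≤ Λ) :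
    ∃ (Hlim : F → W) (φ : ℕ → ℕ), StrictMono φ ∧ ContDiffOn ℝ ∞ Hlim O ∧
      (∀ (k : ℕ), ∀ K ⊆ O, IsCompact K →
        Tendsto (fun j ↦ supCkENorm K k (H (φ j) - Hlim)) atTop (𝓝 0)) ∧
      ∀ y ∈ O, Tendsto (fun j ↦ H (φ j) y) atTop (𝓝 (Hlim y)) := by
  obtain ⟨Hlim, φ, hφ, hHlim, hev⟩ :=
    exists_strictMono_contDiffOn_infty_eventually_norm_iteratedFDeriv_sub_lt hO hHs hb
  have hat : ∀ (k : ℕ) n, ∀ x ∈ O, ContDiffAt ℝ k (H n) x := fun k n x hx ↦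
    ((hHs n).of_le (by exact_mod_cast le_top)).contDiffAt (hO.mem_nhds hx)
  have hlat : ∀ (k : ℕ), ∀ x ∈ O, ContDiffAt ℝ k Hlim x := fun k x hx ↦
    (hHlim.of_le (by exact_mod_cast le_top)).contDiffAt (hO.mem_nhds hx)
  have hconv : ∀ (k : ℕ), ∀ K ⊆ O, IsCompact K →
      Tendsto (fun j ↦ supCkENorm K k (H (φ j) - Hlim)) atTop (𝓝 0) := fun k K hKO hK ↦
    tendsto_supCkENorm_sub_of_eventually_lt (fun j x hx ↦ hat k (φ j) x (hKO hx))
      (fun x hx ↦ hlat k x (hKO hx)) (hev k K hKO hK)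
  refine ⟨Hlim, φ, hφ, hHlim, hconv, fun y hy ↦ ?_⟩
  exact tendsto_apply_of_tendsto_supCkENorm (k := 0) (mem_singleton y)
    (fun j ↦ hat 0 (φ j) y hy) (hlat 0 y hy) (hconv 0 {y} (singleton_subset_iff.2 hy) isCompact_singleton)

/-- A pointwise limit of symmetric bilinear forms is symmetric. [folklore] -/
theorem symm_of_tendsto_bilin {A : ℕ → F →L[ℝ] F →L[ℝ] ℝ} {Alim : F →L[ℝ] F →L[ℝ] ℝ}
    (h : Tendsto A atTop (𝓝 Alim)) (hs : ∀ n v w, A n v w = A n w v) (v w : F) :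
    Alim v w = Alim w v := by
  have hev : ∀ a b : F, Tendsto (fun n ↦ A n a b) atTop (𝓝 (Alim a b)) := fun a b ↦
    ((ContinuousLinearMap.apply ℝ ℝ b).continuous.tendsto _).comp
      (((ContinuousLinearMap.apply ℝ (F →L[ℝ] ℝ) a).continuous.tendsto _).comp h)
  have h1 := hev v w
  have h3 : (fun n ↦ A n v w) = fun n ↦ A n w v := funext fun n ↦ hs n v w
  rw [h3] at h1
  exact tendsto_nhds_unique h1 (hev w v)

/-- A pointwise limit of forms of norm `≤ θ` has norm `≤ θ`. [folklore] -/
theorem norm_le_of_tendsto_bilin {A : ℕ → F →L[ℝ] F →L[ℝ] ℝ} {Alim : F →L[ℝ] F →L[ℝ] ℝ} {θ : ℝ}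
    (h : Tendsto A atTop (𝓝 Alim)) (hle : ∀ n, ‖A n‖ ≤ θ) : ‖Alim‖ ≤ θ :=
  le_of_tendsto' ((continuous_norm.tendsto Alim).comp h) hle

end SupNorm

namespace Spacetime

variable {𝓢ₙ : ℕ → Spacetime.{u} 4} {pₙ : ∀ n, (𝓢ₙ n).carrier} {O : Opens E4}

/-- **Local Cheeger–Gromov compactness for uniformly tame pointed spacetimes** (module docstring).
[cite: Petersen2006, Ch. 10 §3.2] -/
theorem exists_nearMinkowskiChart_subconvergesLocallyTo (hO : IsConnected (O : Set E4)) {y₀ : E4}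
    (hy₀ : y₀ ∈ (O : Set E4)) (Ψ : ∀ n, O → (𝓢ₙ n).carrier)
    (hΨ : ∀ n, ContMDiff 𝓘(ℝ, E4) (𝓡 4) ∞ (Ψ n)) (hinj : ∀ n, Injective (Ψ n))
    (hcentre : ∀ n, Ψ n ⟨y₀, hy₀⟩ = pₙ n)
    (hfut : ∀ n, (𝓢ₙ n).timeOrientation.IsFutureDirected
      (mfderiv 𝓘(ℝ, E4) (𝓡 4) (Ψ n) ⟨y₀, hy₀⟩ (E4.basisVector 0)))
    {θ : ℝ} (hθ : θ < 1)
    (hpinch : ∀ n, ∀ y ∈ (O : Set E4),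
      ‖(𝓢ₙ n).deviationExtend (Minkowski.backgroundOn O) (Ψ n) y‖ ≤ θ)
    (hbound : ∀ k : ℕ, ∃ Λ : ℝ≥0∞, Λ ≠ ⊤ ∧
      ∀ n, supCkENorm (O : Set E4) k ((𝓢ₙ n).deviationExtend (Minkowski.backgroundOn O) (Ψ n)) ≤ Λ) :
    ∃ (L : NearMinkowskiChart O) (φ : ℕ → ℕ), StrictMono φ ∧
      (∀ y ∈ (O : Set E4), ‖L.G y - Minkowski.bilin‖ ≤ θ) ∧
      (∀ (k : ℕ) (C : ℝ≥0∞), (∀ n, supCkENorm (O : Set E4) k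
          ((𝓢ₙ n).deviationExtend (Minkowski.backgroundOn O) (Ψ n)) ≤ C) →
        supCkENorm (O : Set E4) k (L.G - fun _ ↦ Minkowski.bilin) ≤ C) ∧
      (∀ (k : ℕ), ∀ K ⊆ (O : Set E4), IsCompact K →
        Tendsto (fun j ↦ supCkENorm K k
          ((𝓢ₙ (φ j)).deviationExtend (Minkowski.backgroundOn O) (Ψ (φ j)) -
            (L.G - fun _ ↦ Minkowski.bilin))) atTop (𝓝 0)) ∧
      ∀ k : ℕ, SubconvergesLocallyTo 𝓢ₙ pₙ (L.spacetime hO) ⟨y₀, hy₀⟩ k := by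
  -- the components minus `η` in the (common) inclusion chart: smooth, with the germs of the deviations
  let z₀ : O := ⟨y₀, hy₀⟩
  let B : ModelBackground := Minkowski.backgroundOn O
  let M : ℕ → E4 → E4 →L[ℝ] E4 →L[ℝ] ℝ := fun n ↦
    (𝓢ₙ n).metricInCoords (Ψ n ∘ (chartAt E4 z₀).symm)
  let H : ℕ → E4 → E4 →L[ℝ] E4 →L[ℝ] ℝ := fun n ↦ M n - B.bilin
  have hHs : ∀ n, ContDiffOn ℝ ∞ (H n) O := fun n ↦
    ((𝓢ₙ n).contDiffOn_metricInCoords O.2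
      ((𝓢ₙ n).contMDiffOn_comp_chartAt_symm B (Ψ n) z₀ (hΨ n))).sub contDiffOn_const
  have hHgerm : ∀ n, ∀ y ∈ (O : Set E4), H n =ᶠ[𝓝 y] (𝓢ₙ n).deviationExtend B (Ψ n) :=
    fun n y hy ↦ (𝓢ₙ n).metricInCoords_comp_chartAt_symm_sub_eventuallyEq B (Ψ n) z₀ (hΨ n) hy
  have hHeq : ∀ n, ∀ y ∈ (O : Set E4), H n y = (𝓢ₙ n).deviationExtend B (Ψ n) y :=
    fun n y hy ↦ (hHgerm n y hy).eq_of_nhds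
  have hHsup : ∀ n (K : Set E4), K ⊆ (O : Set E4) → ∀ k,
      supCkENorm K k (H n) = supCkENorm K k ((𝓢ₙ n).deviationExtend B (Ψ n)) :=
    fun n K hK k ↦ supCkENorm_congr fun y hy ↦ hHgerm n y (hK hy)
  -- uniform bounds on every derivative on `O`
  have hb : ∀ (i : ℕ), ∀ K ⊆ (O : Set E4), IsCompact K →
      ∃ Λ : ℝ, ∀ n, ∀ z ∈ K, ‖iteratedFDeriv ℝ i (H n) z‖ ≤ Λ := by
    intro i K hKO _
    obtain ⟨Λ, hΛ, hΛb⟩ := hbound i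
    refine ⟨Λ.toReal, fun n z hz ↦ ?_⟩
    have hle : supCkENorm (O : Set E4) i (H n) ≤ Λ := (hHsup n O subset_rfl i).trans_le (hΛb n)
    exact (norm_iteratedFDeriv_le_toReal_supCkENorm le_rfl (hKO hz) (H n)
      (ne_top_of_le_ne_top hΛ hle)).trans (ENNReal.toReal_mono hΛ hle)
  -- the `C^∞` Arzelà–Ascoli extraction
  obtain ⟨Hlim, φ, hφ, hHlim, hconv, hpt⟩ :=
    exists_strictMono_contDiffOn_infty_tendsto_supCkENorm_sub O.2 hHs hb
  -- the limit field `G = Hlim + η`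
  let G : E4 → E4 →L[ℝ] E4 →L[ℝ] ℝ := fun y ↦ Hlim y + Minkowski.bilin
  have hGs : ContDiffOn ℝ ∞ G O := hHlim.add contDiffOn_const
  have hBb : ∀ y, B.bilin y = Minkowski.bilin := fun _ ↦ rfl
  have hGsub : ∀ y, G y - Minkowski.bilin = Hlim y := fun y ↦ by
    ext v w
    simp only [G, sub_apply, add_apply]
    ring
  have hHsymm : ∀ n, ∀ y (v w : E4), H n y v w = H n y w v := fun n y v w ↦ by
    simp only [H, M, Pi.sub_apply, sub_apply, hBb]
    rw [(𝓢ₙ n).metricInCoords_symm _ y v w, Minkowski.bilin_symm v w]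
  have hGsymm : ∀ y ∈ (O : Set E4), ∀ v w : E4, G y v w = G y w v := fun y hy v w ↦ by
    have h := symm_of_tendsto_bilin (hpt y hy) (fun j ↦ hHsymm (φ j) y) v w
    simp only [G, add_apply]
    rw [h, Minkowski.bilin_symm v w]
  have hGpinch : ∀ y ∈ (O : Set E4), ‖G y - Minkowski.bilin‖ ≤ θ := by
    intro y hy
    rw [hGsub y]
    refine norm_le_of_tendsto_bilin (hpt y hy) fun j ↦ ?_
    rw [hHeq (φ j) y hy]
    exact hpinch (φ j) y hy
  let L : NearMinkowskiChart O :=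
    { G := G
      contDiffOn := hGs
      symm := hGsymm
      norm_sub_lt := fun y hy ↦ (hGpinch y hy).trans_lt hθ }
  -- convergence of the components to `G` and of the deviations to `G − η`
  have hGH : ∀ j, M (φ j) - G = H (φ j) - Hlim := fun j ↦ by
    funext y
    ext v w
    simp only [H, G, Pi.sub_apply, sub_apply, add_apply, hBb]
    ring
  have hconvG : ∀ (k : ℕ), ∀ K ⊆ (O : Set E4), IsCompact K →
      Tendsto (fun j ↦ supCkENorm K k (M (φ j) - G)) atTop (𝓝 0) :=
    fun k K hKO hK ↦ (hconv k K hKO hK).congr fun j ↦ by rw [hGH j]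
  have hGm : (G - fun _ ↦ Minkowski.bilin) = Hlim := funext fun y ↦ hGsub y
  have hconvDev : ∀ (k : ℕ), ∀ K ⊆ (O : Set E4), IsCompact K →
      Tendsto (fun j ↦ supCkENorm K k
        ((𝓢ₙ (φ j)).deviationExtend B (Ψ (φ j)) - (G - fun _ ↦ Minkowski.bilin))) atTop (𝓝 0) := by
    intro k K hKO hK
    rw [hGm]
    refine (hconv k K hKO hK).congr fun j ↦ supCkENorm_congr fun y hy ↦ ?_
    exact (hHgerm (φ j) y (hKO hy)).sub EventuallyEq.rfl
  -- the limit inherits the `Cᵏ` bounds (lower semicontinuity of the sup norms)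
  have hbd : ∀ (k : ℕ) (C : ℝ≥0∞), (∀ n, supCkENorm (O : Set E4) k
      ((𝓢ₙ n).deviationExtend B (Ψ n)) ≤ C) →
      supCkENorm (O : Set E4) k (G - fun _ ↦ Minkowski.bilin) ≤ C := by
    intro k C hC
    rw [hGm]
    refine supCkENorm_le_of_forall_le fun m hm z hz ↦ ?_
    have ht : Tendsto (fun j ↦ iteratedFDeriv ℝ m (H (φ j)) z) atTop
        (𝓝 (iteratedFDeriv ℝ m Hlim z)) :=
      tendsto_iteratedFDeriv_of_tendsto_supCkENorm hm (mem_singleton z)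
        (fun j ↦ ((hHs (φ j)).of_le (by exact_mod_cast le_top)).contDiffAt (O.2.mem_nhds hz))
        ((hHlim.of_le (by exact_mod_cast le_top)).contDiffAt (O.2.mem_nhds hz))
        (hconv k {z} (singleton_subset_iff.2 hz) isCompact_singleton)
    refine le_of_tendsto' ((continuous_enorm.tendsto _).comp ht) fun j ↦ ?_
    calc ‖iteratedFDeriv ℝ m (H (φ j)) z‖ₑ ≤ supCkENorm (O : Set E4) k (H (φ j)) :=
          enorm_iteratedFDeriv_le_supCkENorm hm hz _
      _ = supCkENorm (O : Set E4) k ((𝓢ₙ (φ j)).deviationExtend B (Ψ (φ j))) :=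
          hHsup (φ j) O subset_rfl k
      _ ≤ C := hC (φ j)
  refine ⟨L, φ, hφ, hGpinch, hbd, hconvDev, fun k ↦ ?_⟩
  exact SubconvergesLocallyTo.ofCharts hO hy₀ Ψ hΨ hinj hcentre hfut
    (fun n y hy ↦ (hpinch n y hy).trans_lt hθ) L hφ (hconvG k)

/-! ### The form consumed by the Final State Conjecture routes: late ball charts of Minkowski -/

/-- On the coordinate ball `B(0, r₀)` every point has time coordinate `> −r₀`: the late region of
the Minkowski background on the ball after time `−r₀` is the whole ball. [folklore] -/
theorem _root_.Literature.Geometry.Lorentzian.Minkowski.lateRegion_backgroundOn_ball_eq_univ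
    (r₀ : ℝ) :
    (Minkowski.backgroundOn ⟨Metric.ball (0 : E4) r₀, Metric.isOpen_ball⟩).lateRegion (-r₀) =
      univ := by
  refine eq_univ_of_forall fun x ↦ ?_
  have hx' : (x : E4) ∈ Metric.ball (0 : E4) r₀ := x.2
  have hx : ‖(x : E4)‖ < r₀ := by rwa [Metric.mem_ball, dist_zero_right] at hx'
  have h0 : |(x : E4) 0| ≤ ‖(x : E4)‖ := by
    have h := PiLp.norm_apply_le (x : E4) 0
    rwa [Real.norm_eq_abs] at h
  show -r₀ < (x : E4) 0
  have := (abs_lt.1 (h0.trans_lt hx)).1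
  linarith

/-- A late chart of the Minkowski background on the ball `B(0, r₀)` after time `−r₀` is injective
(its late region is the whole ball, on which it is an open embedding). [folklore] -/
theorem injective_of_isLateChart_ball {𝓢 : Spacetime.{u} 4} {r₀ : ℝ} {𝒟 : Set 𝓢.carrier}
    {Ψ : (⟨Metric.ball (0 : E4) r₀, Metric.isOpen_ball⟩ : Opens E4) → 𝓢.carrier}
    (hΨ : 𝓢.IsLateChart (Minkowski.backgroundOn ⟨Metric.ball (0 : E4) r₀, Metric.isOpen_ball⟩) 𝒟
      (-r₀) Ψ) : Injective Ψ := by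
  intro x x' h
  have hinj := hΨ.isOpenEmbedding.injective
  have hx : x ∈ (Minkowski.backgroundOn ⟨Metric.ball (0 : E4) r₀, Metric.isOpen_ball⟩).lateRegion
      (-r₀) := by
    rw [Minkowski.lateRegion_backgroundOn_ball_eq_univ]; exact mem_univ _
  have hx' : x' ∈ (Minkowski.backgroundOn ⟨Metric.ball (0 : E4) r₀, Metric.isOpen_ball⟩).lateRegion
      (-r₀) := by
    rw [Minkowski.lateRegion_backgroundOn_ball_eq_univ]; exact mem_univ _
  have h2 : (⟨x, hx⟩ : (Minkowski.backgroundOn ⟨Metric.ball (0 : E4) r₀,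
      Metric.isOpen_ball⟩).lateRegion (-r₀)) = ⟨x', hx'⟩ := hinj (by simpa using h)
  exact congrArg Subtype.val h2

/-- A `C⁰` sup-norm bound `supCkENorm O 0 f ≤ C` is a pointwise bound on `O`. [folklore] -/
theorem _root_.Literature.Geometry.Lorentzian.norm_le_of_supCkENorm_zero_le {F W : Type*}
    [NormedAddCommGroup F] [NormedSpace ℝ F] [NormedAddCommGroup W] [NormedSpace ℝ W]
    {O : Set F} {f : F → W} {C : ℝ≥0∞} (hC : C ≠ ⊤) (h : supCkENorm O 0 f ≤ C) {y : F}
    (hy : y ∈ O) : ‖f y‖ ≤ C.toReal := by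
  have h1 := norm_iteratedFDeriv_le_toReal_supCkENorm le_rfl hy f (ne_top_of_le_ne_top hC h)
  rw [norm_iteratedFDeriv_zero] at h1
  exact h1.trans (ENNReal.toReal_mono hC h)

/-- Coordinate balls are connected. [folklore] -/
theorem _root_.Literature.Geometry.Lorentzian.isConnected_ball_E4 {r₀ : ℝ} (hr₀ : 0 < r₀) :
    IsConnected (Metric.ball (0 : E4) r₀) :=
  ⟨⟨0, Metric.mem_ball_self hr₀⟩, (convex_ball (0 : E4) r₀).isPreconnected⟩

/-- **Local Cheeger–Gromov compactness, Final-State-Conjecture form.** Pointed spacetimes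
`(𝓢ₙ, pₙ)` carrying, about their base points, late charts of the Minkowski background on the
coordinate ball `B(0, r₀)` (the per-point clause of hypothesis (ii) of the tame final-state routes:
`IsLateChart`, centred, deviation `≤ 1/2` in `C⁰`) whose deviations are bounded in EVERY `Cᵏ`
uniformly in `n`, and which push `∂₀` to the future at the centre, subconverge — in the pointed
`Cᵏ_loc` sense for every `k` — to the near-Minkowski chart spacetime of a smooth limit field `G` on
the ball with `‖G − η‖ ≤ 1/2`, the deviations converging to `G − η` in every `Cᵏ` on compact
sub-balls. [cite: Petersen2006, Ch. 10 §3.2] -/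
theorem exists_nearMinkowskiChart_subconvergesLocallyTo_of_isLateChart {r₀ : ℝ} (hr₀ : 0 < r₀)
    (Ψ : ∀ n, (⟨Metric.ball (0 : E4) r₀, Metric.isOpen_ball⟩ : Opens E4) → (𝓢ₙ n).carrier)
    {𝒟 : ∀ n, Set (𝓢ₙ n).carrier}
    (hΨ : ∀ n, (𝓢ₙ n).IsLateChart
      (Minkowski.backgroundOn ⟨Metric.ball (0 : E4) r₀, Metric.isOpen_ball⟩) (𝒟 n) (-r₀) (Ψ n))
    (hcentre : ∀ n, Ψ n ⟨0, Metric.mem_ball_self hr₀⟩ = pₙ n)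
    (hfut : ∀ n, (𝓢ₙ n).timeOrientation.IsFutureDirected
      (mfderiv 𝓘(ℝ, E4) (𝓡 4) (Ψ n) ⟨0, Metric.mem_ball_self hr₀⟩ (E4.basisVector 0)))
    (hpinch : ∀ n, supCkENorm (Metric.ball (0 : E4) r₀) 0 ((𝓢ₙ n).deviationExtend
      (Minkowski.backgroundOn ⟨Metric.ball (0 : E4) r₀, Metric.isOpen_ball⟩) (Ψ n)) ≤ 1 / 2)
    (hbound : ∀ k : ℕ, ∃ Λ : NNReal, ∀ n, supCkENorm (Metric.ball (0 : E4) r₀) k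
      ((𝓢ₙ n).deviationExtend
        (Minkowski.backgroundOn ⟨Metric.ball (0 : E4) r₀, Metric.isOpen_ball⟩) (Ψ n)) ≤ Λ) :
    ∃ (L : NearMinkowskiChart ⟨Metric.ball (0 : E4) r₀, Metric.isOpen_ball⟩) (φ : ℕ → ℕ),
      StrictMono φ ∧
      (∀ y ∈ Metric.ball (0 : E4) r₀, ‖L.G y - Minkowski.bilin‖ ≤ 1 / 2) ∧
      (∀ (k : ℕ) (Λ : NNReal), (∀ n, supCkENorm (Metric.ball (0 : E4) r₀) k
          ((𝓢ₙ n).deviationExtend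
            (Minkowski.backgroundOn ⟨Metric.ball (0 : E4) r₀, Metric.isOpen_ball⟩) (Ψ n)) ≤ Λ) →
        supCkENorm (Metric.ball (0 : E4) r₀) k (L.G - fun _ ↦ Minkowski.bilin) ≤ Λ) ∧
      (∀ (k : ℕ), ∀ K ⊆ Metric.ball (0 : E4) r₀, IsCompact K →
        Tendsto (fun j ↦ supCkENorm K k
          ((𝓢ₙ (φ j)).deviationExtend
              (Minkowski.backgroundOn ⟨Metric.ball (0 : E4) r₀, Metric.isOpen_ball⟩) (Ψ (φ j)) -
            (L.G - fun _ ↦ Minkowski.bilin))) atTop (𝓝 0)) ∧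
      ∀ k : ℕ, SubconvergesLocallyTo 𝓢ₙ pₙ (L.spacetime (isConnected_ball_E4 hr₀))
        ⟨0, Metric.mem_ball_self hr₀⟩ k := by
  have h12 : ((1 : ℝ≥0∞) / 2).toReal = 1 / 2 := by
    rw [ENNReal.toReal_div]; simp
  obtain ⟨L, φ, hφ, h1, h2, h3, h4⟩ := exists_nearMinkowskiChart_subconvergesLocallyTo
    (isConnected_ball_E4 hr₀) (Metric.mem_ball_self hr₀) Ψ (fun n ↦ (hΨ n).contMDiff)
    (fun n ↦ injective_of_isLateChart_ball (hΨ n)) hcentre hfut (θ := 1 / 2) one_half_lt_one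
    (fun n y hy ↦ by
      have h := norm_le_of_supCkENorm_zero_le (by simp) (hpinch n) hy
      rwa [h12] at h)
    fun k ↦ by
      obtain ⟨Λ, hΛ⟩ := hbound k
      exact ⟨Λ, ENNReal.coe_ne_top, hΛ⟩
  exact ⟨L, φ, hφ, h1, fun k Λ hΛ ↦ h2 k Λ hΛ, h3, h4⟩

end Spacetime

end Literature.Geometry.Lorentzian

end
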